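import Literature.AnabelianGeometry.EtaleTheta.LogDivisorModelTateTowerTheta
import Literature.AnabelianGeometry.EtaleTheta.LogDivisorModelTateTowerKummer

/-!
# [EtTh] Def. 3.3 (iii) at the `Ÿ`-skeleton with cusps and theta: the Galois action (translation of the chain, with the
# shear of Prop. 1.4 (ii) on the functions), the cusp laws, the Def. 3.3 (iii) data, and the divisor of `Θ̈` under the action
# (Tate tower v3, piece 1b — class (b) NV)

S. Mochizuki, *The étale theta function …*, Publ. RIMS **45** (2009) [MochizukiEtTh2009], Def. 3.3 (iii) / Rmk. 3.3.1 p.73, and §1: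
Prop. 1.4 (ii) p.22 («`Θ̈(q_X^{a/2} Ü) = (−1)^a · q_X^{−a²/2} · Ü^{−2a} · Θ̈(Ü)`»), Prop. 1.4 (i) p.21, Rmk. 1.3.1 p.21 («the divisor
`D_1` on `Ÿ` clearly does not descend») [cite: MochizukiEtTh2009, Def 3.3 p.73].

CLASS (b) MODEL / NON-VACUITY WITNESS (abc-iut cell, layer L2; seat abc-iut-L2-t3 (gen 7), row «TATE TOWER v3, PIECE 1» of
abc-iut-L2-lead R767, second file).  Consumed BY NAME: piece 1a `TateTowerTheta.model` (this seat), the parameter record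
`LogDivisorModel.GaloisAction` / `CuspLaws` and `GaloisAction.comap` (abc-iut-w6-d058), `DivisorMonoids.ofGaloisAction` (abc-iut).
THIS FILE:
* the translation `a ∈ ℤ` of the chain on prime log-divisors (`shiftIdx`: `F_j ↦ F_{j+a}`, cusp `(j, ±) ↦ (j+a, ±)`), on log-divisors
  (`shiftDIV`), and on functions the COVARIANT shear read off Prop. 1.4 (ii) (`shear a (ε, c, k, t) = (ε + a·t, c − a·k − a²·t,
  k + 2a·t, t)`: `Ü ↦ ϖ̈^{−a} Ü`, `Θ̈ ↦ (−1)^a ϖ̈^{−a²} Ü^{2a} Θ̈` — the functional equation with `a ↦ −a`, matching the convention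
  `U ↦ ϖ^{−a} U` of `TateTower.action`);
* **`TateTowerTheta.baseAction : model.GaloisAction (Multiplicative ℤ)`, ALL laws PROVED** — in particular `divisor_act` is the
  identity `(c − ak − a²t) + (k + 2at)·j − t·j² = c + k(j − a) − t(j − a)²` — and `action φ := baseAction.comap φ` for any group `Γ`
  with a character `φ : Γ → ℤ`; the cusp laws `cuspLaws`; hence the Def. 3.3 (iii) data `DivisorMonoids.ofGaloisAction (action φ)
  cuspLaws` with a NON-TRIVIAL action AND cusps (`nonempty_divisorMonoids`);
* NV of the divisor of `Θ̈` under the action: the zero divisor (all cusps) is translation-INVARIANT (`actDIV_thetaZeros`) — so it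
  is an element of `Φ₀(S)` for EVERY `Γ`-set `S` (`thetaZerosPhi`, cuspidal, `≠ 1`: the cuspidal part of `Φ₀` has content, unlike
  at `TateTower.model`); the polar divisor `D_1` is translation-covariant EXACTLY up to the principal divisor of `ϖ̈^{a²} Ü^{−2a}`
  (`actDIV_thetaPoles`) and is moved by every `a ≠ 0` (`actDIV_thetaPoles_ne`: it lives over the coverings killing the
  translation, cf. Rmk. 1.3.1); `actFn_theta` = Prop. 1.4 (ii) in the skeleton.
HONEST FRAMING: a combinatorial consistency witness (NOT the formal scheme `Ÿ`; the `Y`/`Ÿ` half-integrality of Rmk. 1.3.1 is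
not modelled — `ord q_X^{1/2} = 1` here); defs + theorems only, no Prop-valued fact, no instance, no notation, no sorry;
nothing here bears on [IUTchIII] Cor. 3.12; no side taken; typed ≠ proved.
-/

noncomputable section

namespace Literature.AnabelianGeometry.EtaleTheta

open CategoryTheory

namespace LogDivisorModel

namespace TateTowerTheta

/-! ## Translation of the chain on prime log-divisors and on log-divisors -/

/-- Translation by `a`: `F_j ↦ F_{j+a}`, cusp `(j, ±) ↦ (j + a, ±)`. [cite: MochizukiEtTh2009, Rmk 3.3.1 p.73] -/
def shiftIdx (a : ℤ) : Idx ≃ Idx :=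
  Equiv.sumCongr (Equiv.prodCongr (Equiv.addRight a) (Equiv.refl Bool)) (Equiv.addRight a)

/-- `shiftIdx` on a cusp. [cite: MochizukiEtTh2009, Rmk 3.3.1 p.73] -/
@[simp] theorem shiftIdx_inl (a j : ℤ) (b : Bool) : shiftIdx a (Sum.inl (j, b)) = Sum.inl (j + a, b) := rfl
/-- `shiftIdx` on a component. [cite: MochizukiEtTh2009, Rmk 3.3.1 p.73] -/
@[simp] theorem shiftIdx_inr (a j : ℤ) : shiftIdx a (Sum.inr j) = Sum.inr (j + a) := rfl
/-- Inverse translation on a cusp. [cite: MochizukiEtTh2009, Rmk 3.3.1 p.73] -/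
@[simp] theorem shiftIdx_symm_inl (a j : ℤ) (b : Bool) : (shiftIdx a).symm (Sum.inl (j, b)) = Sum.inl (j - a, b) := by
  rw [Equiv.symm_apply_eq, shiftIdx_inl, sub_add_cancel]
/-- Inverse translation on a component. [cite: MochizukiEtTh2009, Rmk 3.3.1 p.73] -/
@[simp] theorem shiftIdx_symm_inr (a j : ℤ) : (shiftIdx a).symm (Sum.inr j) = Sum.inr (j - a) := by
  rw [Equiv.symm_apply_eq, shiftIdx_inr, sub_add_cancel]

/-- The action of the translation `a` on log-divisors: `d ↦ d ∘ (shift a)⁻¹`. [cite: MochizukiEtTh2009, Def 3.3 p.73] -/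
def shiftDIV (a : ℤ) : Multiplicative (Idx → ℤ) ≃* Multiplicative (Idx → ℤ) where
  toFun d := Multiplicative.ofAdd fun x => Multiplicative.toAdd d ((shiftIdx a).symm x)
  invFun d := Multiplicative.ofAdd fun x => Multiplicative.toAdd d (shiftIdx a x)
  left_inv d := Multiplicative.toAdd.injective (funext fun x => by simp)
  right_inv d := Multiplicative.toAdd.injective (funext fun x => by simp)
  map_mul' _ _ := Multiplicative.toAdd.injective (funext fun x => by simp)

/-- `shiftDIV a d` evaluated. [cite: MochizukiEtTh2009, Def 3.3 p.73] -/
@[simp] theorem toAdd_shiftDIV (a : ℤ) (d : Multiplicative (Idx → ℤ)) (x : Idx) :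
    Multiplicative.toAdd (shiftDIV a d) x = Multiplicative.toAdd d ((shiftIdx a).symm x) := by
  simp [shiftDIV]

/-! ## The shear of Prop. 1.4 (ii) on the functions -/

/-- **The covariant action of the translation `a` on `(−1)^ε ϖ̈^c Ü^k Θ̈^t`**: `Ü ↦ ϖ̈^{−a} Ü` and, by Prop. 1.4 (ii) read at `−a`,
`Θ̈ ↦ (−1)^a ϖ̈^{−a²} Ü^{2a} Θ̈`; on exponent vectors `(ε, c, k, t) ↦ (ε + a·t, c − a·k − a²·t, k + 2a·t, t)`.
[cite: MochizukiEtTh2009, Prop 1.4 p.22] -/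
def shear (a : ℤ) (f : Exp) : Exp :=
  (f.1 + (((a * eT f : ℤ)) : ZMod 2), eC f - a * eU f - a * a * eT f, eU f + 2 * a * eT f, eT f)

/-- Sign of a sheared function. [cite: MochizukiEtTh2009, Prop 1.4 p.22] -/
@[simp] theorem fst_shear (a : ℤ) (f : Exp) : (shear a f).1 = f.1 + (((a * eT f : ℤ)) : ZMod 2) := rfl
/-- `ϖ̈`-exponent of a sheared function. [cite: MochizukiEtTh2009, Prop 1.4 p.22] -/
@[simp] theorem eC_shear (a : ℤ) (f : Exp) : eC (shear a f) = eC f - a * eU f - a * a * eT f := rfl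
/-- `Ü`-exponent of a sheared function. [cite: MochizukiEtTh2009, Prop 1.4 p.22] -/
@[simp] theorem eU_shear (a : ℤ) (f : Exp) : eU (shear a f) = eU f + 2 * a * eT f := rfl
/-- `Θ̈`-exponent is unchanged. [cite: MochizukiEtTh2009, Prop 1.4 p.22] -/
@[simp] theorem eT_shear (a : ℤ) (f : Exp) : eT (shear a f) = eT f := rfl

/-- The shear is additive in the function. [cite: MochizukiEtTh2009, Prop 1.4 p.22] -/
theorem shear_add_fun (a : ℤ) (f g : Exp) : shear a (f + g) = shear a f + shear a g :=
  ext_exp (by simp only [fst_shear, Prod.fst_add, eT_add]; push_cast; ring) (by simp only [eC_shear, eC_add, eU_add, eT_add]; ring)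
    (by simp only [eU_shear, eU_add, eT_add]; ring) (by simp only [eT_shear, eT_add])

/-- Shearing by `0` is the identity. [cite: MochizukiEtTh2009, Prop 1.4 p.22] -/
theorem shear_zero (f : Exp) : shear 0 f = f :=
  ext_exp (by simp) (by simp) (by simp) (by simp)

/-- **Shears compose additively** (the translations form a group acting on `Fn`). [cite: MochizukiEtTh2009, Prop 1.4 p.22] -/
theorem shear_add (a a' : ℤ) (f : Exp) : shear (a + a') f = shear a (shear a' f) :=
  ext_exp (by simp only [fst_shear, eT_shear]; push_cast; ring) (by simp only [eC_shear, eU_shear, eT_shear]; ring)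
    (by simp only [eU_shear, eT_shear]; ring) (by simp only [eT_shear])

/-- The shear fixes the constants `μ₂ × ⟨ϖ̈⟩`. [cite: MochizukiEtTh2009, Prop 1.4 p.22] -/
theorem shear_eq_self_of_const (a : ℤ) {e : Exp} (hk : eU e = 0) (ht : eT e = 0) : shear a e = e :=
  ext_exp (by rw [fst_shear, ht, mul_zero, Int.cast_zero, add_zero]) (by rw [eC_shear, hk, ht, mul_zero, mul_zero, sub_zero, sub_zero])
    (by rw [eU_shear, ht, mul_zero, add_zero]) (by rw [eT_shear])

/-- **Prop. 1.4 (ii) on exponent vectors**: `a · Θ̈ = (−1)^a ϖ̈^{−a²} Ü^{2a} Θ̈`. [cite: MochizukiEtTh2009, Prop 1.4 p.22] -/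
theorem shear_theta (a : ℤ) : shear a ((0, 0, 0, 1) : Exp) = (((a : ℤ) : ZMod 2), -(a * a), 2 * a, 1) := by
  simp [shear, eC, eU, eT]

/-- `a · Ü = ϖ̈^{−a} Ü`. [cite: MochizukiEtTh2009, Prop 1.4 p.22] -/
theorem shear_coordU (a : ℤ) : shear a ((0, 0, 1, 0) : Exp) = (0, -a, 1, 0) := by
  simp [shear, eC, eU, eT]

/-- The shear by `a` as an automorphism of `Fn = μ₂ × ℤ³`. [cite: MochizukiEtTh2009, Prop 1.4 p.22] -/
def shearFn (a : ℤ) : Multiplicative Exp ≃* Multiplicative Exp where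
  toFun f := Multiplicative.ofAdd (shear a (Multiplicative.toAdd f))
  invFun f := Multiplicative.ofAdd (shear (-a) (Multiplicative.toAdd f))
  left_inv f := Multiplicative.toAdd.injective (by simp only [toAdd_ofAdd, ← shear_add, neg_add_cancel, shear_zero])
  right_inv f := Multiplicative.toAdd.injective (by simp only [toAdd_ofAdd, ← shear_add, add_neg_cancel, shear_zero])
  map_mul' f g := Multiplicative.toAdd.injective (by simp only [toAdd_ofAdd, toAdd_mul, shear_add_fun])

/-- `shearFn a f` evaluated. [cite: MochizukiEtTh2009, Prop 1.4 p.22] -/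
@[simp] theorem toAdd_shearFn (a : ℤ) (f : Multiplicative Exp) :
    Multiplicative.toAdd (shearFn a f) = shear a (Multiplicative.toAdd f) := by
  simp [shearFn]

/-! ## The Galois action of the translations `ℤ` -/

/-- `ℤ` acting on the functions of `Ÿ`. [cite: MochizukiEtTh2009, Def 3.3 p.73] -/
def actFnHom : Multiplicative ℤ →* MulAut (Multiplicative Exp) where
  toFun g := shearFn (Multiplicative.toAdd g)
  map_one' := MulEquiv.ext fun f => Multiplicative.toAdd.injective (by simp [shear_zero])
  map_mul' g h := MulEquiv.ext fun f => Multiplicative.toAdd.injective (by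
    rw [MulAut.mul_apply]
    simp only [toAdd_shearFn, toAdd_mul, shear_add])

/-- `ℤ` acting on the log-divisors of `Ÿ`. [cite: MochizukiEtTh2009, Def 3.3 p.73] -/
def actDIVHom : Multiplicative ℤ →* MulAut (Multiplicative (Idx → ℤ)) where
  toFun g := shiftDIV (Multiplicative.toAdd g)
  map_one' := MulEquiv.ext fun d => Multiplicative.toAdd.injective (funext fun x => by
    rw [toAdd_shiftDIV, MulAut.one_apply, toAdd_one]
    rcases x with ⟨j, b⟩ | j
    · rw [shiftIdx_symm_inl, sub_zero]
    · rw [shiftIdx_symm_inr, sub_zero])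
  map_mul' g h := MulEquiv.ext fun d => Multiplicative.toAdd.injective (funext fun x => by
    rw [MulAut.mul_apply, toAdd_shiftDIV, toAdd_shiftDIV, toAdd_shiftDIV, toAdd_mul]
    rcases x with ⟨j, b⟩ | j
    · simp only [shiftIdx_symm_inl, sub_sub]
    · simp only [shiftIdx_symm_inr, sub_sub])

/-- `ℤ` translating the components (as for the Tate skeleton). [cite: MochizukiEtTh2009, Rmk 3.3.1 p.73] -/
def permCompHom : Multiplicative ℤ →* Equiv.Perm ℤ := TateTower.permCompHom

/-- `ℤ` translating the cusps `(j, ±) ↦ (j + a, ±)`. [cite: MochizukiEtTh2009, Rmk 3.3.1 p.73] -/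
def permCuspHom : Multiplicative ℤ →* Equiv.Perm Cusp where
  toFun g := Equiv.prodCongr (permCompHom g) (Equiv.refl Bool)
  map_one' := by rw [map_one]; exact Equiv.ext fun _ => rfl
  map_mul' g h := by rw [map_mul]; exact Equiv.ext fun _ => rfl

/-- The permutation of the prime log-divisors IS `shiftIdx`. [cite: MochizukiEtTh2009, Rmk 3.3.1 p.73] -/
theorem sum_map_perm (g : Multiplicative ℤ) (x : Idx) :
    Sum.map (permCuspHom g) (permCompHom g) x = shiftIdx (Multiplicative.toAdd g) x := by
  rcases x with ⟨j, b⟩ | j <;> rfl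

/-- **The Galois action of the translations `ℤ` on the `Ÿ`-skeleton with cusps and theta** (every law proved).
[cite: MochizukiEtTh2009, Def 3.3 p.73] -/
def baseAction : model.GaloisAction (Multiplicative ℤ) where
  actFn := actFnHom
  actDIV := actDIVHom
  permCusp := permCuspHom
  permComp := permCompHom
  act_mem_DIVplus g d hd := (ofAdd_mem_effective_iff _).2 fun x => hd _
  act_mem_Div _ _ _ := trivial
  act_mem_logMero _ _ _ := trivial
  act_mem_const g f hf := by
    refine ⟨?_, ?_⟩
    · change eU (shear (Multiplicative.toAdd g) (Multiplicative.toAdd f)) = 0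
      rw [eU_shear, hf.1, hf.2, mul_zero, add_zero]
    · change eT (shear (Multiplicative.toAdd g) (Multiplicative.toAdd f)) = 0
      rw [eT_shear, hf.2]
  act_mem_intConst g f hf := by
    refine ⟨?_, ?_, ?_⟩
    · change 0 ≤ eC (shear (Multiplicative.toAdd g) (Multiplicative.toAdd f))
      rw [eC_shear, hf.2.1, hf.2.2, mul_zero, mul_zero, sub_zero, sub_zero]
      exact hf.1
    · change eU (shear (Multiplicative.toAdd g) (Multiplicative.toAdd f)) = 0
      rw [eU_shear, hf.2.1, hf.2.2, mul_zero, add_zero]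
    · change eT (shear (Multiplicative.toAdd g) (Multiplicative.toAdd f)) = 0
      rw [eT_shear, hf.2.2]
  divisor_act g f := by
    refine Multiplicative.toAdd.injective (funext fun x => ?_)
    change divFun (shear (Multiplicative.toAdd g) (Multiplicative.toAdd f.1)) x =
      Multiplicative.toAdd (shiftDIV (Multiplicative.toAdd g) (divHom f.1)) x
    rw [toAdd_shiftDIV, toAdd_divHom]
    rcases x with ⟨j, b⟩ | j
    · rw [shiftIdx_symm_inl, divFun_inl, divFun_inl, eT_shear]
    · rw [shiftIdx_symm_inr, divFun_inr, divFun_inr, eC_shear, eU_shear, eT_shear]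
      ring
  mult_act g d x := by
    change (Multiplicative.toAdd (shiftDIV (Multiplicative.toAdd g) d.1) (Sum.map (permCuspHom g) (permCompHom g) x)).toNat =
      (Multiplicative.toAdd d.1 x).toNat
    rw [toAdd_shiftDIV, sum_map_perm, Equiv.symm_apply_apply]
    rfl

/-- The tacit cusp laws hold (cuspidal = no multiplicity along the chain; every log-divisor Cartier).
[cite: MochizukiEtTh2009, Def 3.1 p.70] -/
theorem cuspLaws : model.CuspLaws where
  cuspidal_le_Div := fun _ _ => trivial
  mem_cuspidal_iff d := by
    refine forall_congr' fun j => ?_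
    rw [mult_eq, Int.toNat_eq_zero]
    exact ⟨fun h => h.le, fun h => le_antisymm h (d.2 _)⟩

variable {Γ : Type} [Group Γ] (φ : Γ →* Multiplicative ℤ)

/-- **The action of an arbitrary group `Γ` through a character `φ : Γ → ℤ`** (print: `Π^tp_X` acts on the chain through
`Π^tp_X ↠ Gal(Y/X) = ℤ`). [cite: MochizukiEtTh2009, Def 3.3 p.73] -/
def action : model.GaloisAction Γ := baseAction.comap φ

/-- **The Def. 3.3 (iii) data of the `Ÿ`-skeleton**: `DivisorMonoids.ofGaloisAction` at a non-trivial action WITH cusps exists.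
[cite: MochizukiEtTh2009, Def 3.3 p.73] -/
theorem nonempty_divisorMonoids (ψ : Γ →* Multiplicative ℤ) : Nonempty (DivisorMonoids.{1, 0, 0} (Action (Type 0) Γ)) :=
  ⟨DivisorMonoids.ofGaloisAction (action ψ) cuspLaws⟩

/-! ## The divisor of `Θ̈` under the action -/

/-- **The zero divisor of `Θ̈` (all cusps, multiplicity `1`) is translation-INVARIANT.** [cite: MochizukiEtTh2009, Prop 1.4 p.21] -/
theorem actDIV_thetaZeros (g : Γ) : (action φ).actDIV g (thetaZeros : model.DIV) = thetaZeros := by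
  refine Multiplicative.toAdd.injective (funext fun x => ?_)
  change Multiplicative.toAdd (shiftDIV (Multiplicative.toAdd (φ g)) (Multiplicative.ofAdd zerosFun)) x = zerosFun x
  rw [toAdd_shiftDIV, toAdd_ofAdd]
  rcases x with ⟨j, b⟩ | j
  · rw [shiftIdx_symm_inl]; rfl
  · rw [shiftIdx_symm_inr]; rfl

/-- The function `ϖ̈^{a²} Ü^{−2a}` (no sign, no `Θ̈`). [cite: MochizukiEtTh2009, Prop 1.4 p.22] -/
def polarCorrection (a : ℤ) : model.Fn := Multiplicative.ofAdd ((0, a * a, -(2 * a), 0) : Exp)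

/-- **`D_1` is translation-covariant EXACTLY up to a principal divisor**: `a · D_1 = D_1 + div(ϖ̈^{a²} Ü^{−2a})`
(`(j − a)² = j² − 2a·j + a²`). [cite: MochizukiEtTh2009, Prop 1.4 p.22] -/
theorem actDIV_thetaPoles (g : Γ) :
    (action φ).actDIV g (thetaPoles : model.DIV) =
      (thetaPoles : model.DIV) * model.divisor ⟨polarCorrection (Multiplicative.toAdd (φ g)), Subgroup.mem_top _⟩ := by
  refine Multiplicative.toAdd.injective (funext fun x => ?_)
  change Multiplicative.toAdd (shiftDIV (Multiplicative.toAdd (φ g)) (Multiplicative.ofAdd polesFun)) x =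
    polesFun x + divFun ((0, Multiplicative.toAdd (φ g) * Multiplicative.toAdd (φ g), -(2 * Multiplicative.toAdd (φ g)), 0) : Exp) x
  rw [toAdd_shiftDIV, toAdd_ofAdd]
  rcases x with ⟨j, b⟩ | j
  · rw [shiftIdx_symm_inl]; rfl
  · rw [shiftIdx_symm_inr, divFun_inr]
    change (j - _) * (j - _) = j * j + _
    simp only [eC, eU, eT]
    ring

/-- **`D_1` is moved by every non-trivial translation** (it is defined over the coverings on which the translation acts
trivially; cf. Rmk. 1.3.1 «`D_1` … does not descend»). [cite: MochizukiEtTh2009, Rmk 1.3.1 p.21] -/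
theorem actDIV_thetaPoles_ne {g : Γ} (hg : φ g ≠ 1) : (action φ).actDIV g (thetaPoles : model.DIV) ≠ thetaPoles := fun h => by
  have e := congrArg (fun d : model.DIV => Multiplicative.toAdd d (Sum.inr (0 : ℤ))) h
  change Multiplicative.toAdd (shiftDIV (Multiplicative.toAdd (φ g)) (Multiplicative.ofAdd polesFun)) (Sum.inr 0) =
    polesFun (Sum.inr 0) at e
  rw [toAdd_shiftDIV, toAdd_ofAdd, shiftIdx_symm_inr] at e
  change (0 - Multiplicative.toAdd (φ g)) * (0 - Multiplicative.toAdd (φ g)) = 0 * 0 at e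
  have h0 : Multiplicative.toAdd (φ g) = 0 := by simpa using e
  exact hg (by rw [← ofAdd_toAdd (φ g), h0, ofAdd_zero])

/-- **Prop. 1.4 (ii) in the skeleton** (covariant form): `a · Θ̈ = (−1)^a ϖ̈^{−a²} Ü^{2a} Θ̈`.
[cite: MochizukiEtTh2009, Prop 1.4 p.22] -/
theorem actFn_theta (g : Γ) :
    Multiplicative.toAdd ((action φ).actFn g theta) =
      (((Multiplicative.toAdd (φ g) : ℤ) : ZMod 2), -(Multiplicative.toAdd (φ g) * Multiplicative.toAdd (φ g)),
        2 * Multiplicative.toAdd (φ g), 1) :=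
  shear_theta (Multiplicative.toAdd (φ g))

/-- Constants are FIXED by the action (the translations act trivially on `μ₂ × ⟨ϖ̈⟩`; the Galois-correspondence binder of the
constant-field functor then holds with `N = Γ`, as for `TateTower`). [cite: MochizukiEtTh2009, Def 3.3 p.73] -/
theorem actFn_of_mem_const (g : Γ) {f : model.Fn} (hf : f ∈ model.const) : (action φ).actFn g f = f :=
  Multiplicative.toAdd.injective
    (shear_eq_self_of_const (Multiplicative.toAdd (φ g)) hf.1 hf.2 : shear _ (Multiplicative.toAdd f) = Multiplicative.toAdd f)

/-! ## The zero divisor of `Θ̈` as an element of `Φ₀(S)` for every covering -/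

variable (S : Action (Type 0) Γ)

/-- **The zero divisor of `Θ̈` as an element of `Φ₀(S) = Hom_Γ(S, Div⁺)` for EVERY `Γ`-set `S`** (constant family; equivariant
because the divisor is translation-invariant) — a CUSPIDAL element of `Φ₀` with content. [cite: MochizukiEtTh2009, Def 3.3 p.73] -/
def thetaZerosPhi : (action φ).phiZero S :=
  ⟨fun _ => (thetaZeros : model.DIV), fun _ => ⟨trivial, thetaZeros.2⟩, fun g _ => (actDIV_thetaZeros φ g).symm⟩

/-- Its values are the zero divisor. [cite: MochizukiEtTh2009, Def 3.3 p.73] -/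
@[simp] theorem thetaZerosPhi_apply (s : S.V) : (thetaZerosPhi φ S).1 s = (thetaZeros : model.DIV) := rfl

/-- It is non-trivial as soon as `S` is nonempty. [cite: MochizukiEtTh2009, Def 3.3 p.73] -/
theorem thetaZerosPhi_ne_one [h : Nonempty S.V] : thetaZerosPhi φ S ≠ 1 := fun e => by
  obtain ⟨s⟩ := h
  have e1 : (thetaZeros : model.DIV) = 1 := by
    have := congrArg (fun ψ : (action φ).phiZero S => ψ.1 s) e
    exact this
  exact thetaZeros_ne_one (Subtype.ext e1)

/-- Its values are cuspidal log-divisors (supported on the cusps): the cuspidal part of `Φ₀(S)` is NON-TRIVIAL at the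
`Ÿ`-skeleton. [cite: MochizukiEtTh2009, Def 3.1 p.70] -/
theorem thetaZerosPhi_mem_cuspidal (s : S.V) : (thetaZerosPhi φ S).1 s ∈ model.cuspidal := thetaZeros_mem_cuspidal

/-! ## The uniformiser and the coordinate -/

/-- The uniformiser `ϖ̈` (`ord = ord q_X^{1/2} = 1`). [cite: MochizukiEtTh2009, Def 3.1 p.70] -/
def unif : model.Fn := Multiplicative.ofAdd ((0, 1, 0, 0) : Exp)

/-- The coordinate `Ü`. [cite: MochizukiEtTh2009, Prop 1.4 p.21] -/
def coordU : model.Fn := Multiplicative.ofAdd ((0, 0, 1, 0) : Exp)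

/-- The divisor of `ϖ̈` is the whole reduced special fibre `Σ_j [F_j]`. [cite: MochizukiEtTh2009, Def 3.1 p.70] -/
theorem toAdd_divisor_unif (x : Idx) :
    Multiplicative.toAdd (model.divisor ⟨unif, Subgroup.mem_top _⟩) x = Sum.elim (fun _ => (0 : ℤ)) (fun _ => 1) x := by
  change divFun ((0, 1, 0, 0) : Exp) x = _
  rcases x with c | j
  · rfl
  · change (1 : ℤ) + 0 * j - 0 * (j * j) = 1
    ring

/-- The divisor of `Ü` runs linearly along the chain: `F_j ↦ j`, nothing at the cusps. [cite: MochizukiEtTh2009, Prop 1.4 p.21] -/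
theorem toAdd_divisor_coordU (x : Idx) :
    Multiplicative.toAdd (model.divisor ⟨coordU, Subgroup.mem_top _⟩) x = Sum.elim (fun _ => (0 : ℤ)) (fun j => j) x := by
  change divFun ((0, 0, 1, 0) : Exp) x = _
  rcases x with c | j
  · rfl
  · change (0 : ℤ) + 1 * j - 0 * (j * j) = j
    ring

/-- `ϖ̈` is a constant fixed by the action; `Ü` is NOT fixed by a non-trivial translation (`a · Ü = ϖ̈^{−a} Ü`).
[cite: MochizukiEtTh2009, Def 3.3 p.73] -/
theorem actFn_coordU (g : Γ) :
    Multiplicative.toAdd ((action φ).actFn g coordU) = ((0 : ZMod 2), -Multiplicative.toAdd (φ g), (1 : ℤ), (0 : ℤ)) :=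
  shear_coordU (Multiplicative.toAdd (φ g))

end TateTowerTheta

end LogDivisorModel

end Literature.AnabelianGeometry.EtaleTheta

end
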